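import Mathlib
import Summits.Parity.GeneralizedHardyLittlewood.Theorems.PrimeGapTorusCapPart2
import HarnessLib

/-!
# Prime-gap limit points, the torus cap (cell parity-ideate, p4 ROUND-12) — part 3/8 (`min_le_volume_D3_of_conjLinZ_frequently` … `eq_univ_of_pred_closed`)

Source: `HOME/parity-ideate-p4/round12/Sketch16.lean` (sha16 e5770481db81479a, 7 278 lines, farm rc 0 / 0 sorry /
axioms std-3; namespace `ParityIdeateP4R8`), cut by parity-ideate-lit g32 (`ports/toruscap/build_toruscap.py`) to the
dependency cone (143 declarations) of the eight headline declarations `torusCap_iff`, `torusCapBrauer_iff`,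
`torusCap_half`, `cb1_holds`, `conjHalfStrict_holds`, `NearAP.delannoyNonVanishing_holds`, `capGivesCoverage`,
`residueCoverage_half_of_literature`, in a chain of 8 files of ≤ 400 lines (Theorems-side lint); statements byte-identical
to the source except: `NearAP.P0/P1/P2` are `abbrev` (source: `def` + three `Decidable` instances, dropped per the typing
lint), examples and `decide` rungs outside the cone dropped, namespace `ParityIdeateP4R8` ↦ `Summit.Parity.GeneralizedHardyLittlewood.Theorems.PrimeGapTorusCap`.
Non-Mathlib inputs: `Literature.Combinatorics.Additive.ErdosHeilbronn` (combinatorial Nullstellensatz),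
`Literature.NumberTheory.Sieve.PrimeGapLimitPoints` (`primeGapLimitSet`, `HasPointProperty`, the NAMED fact
`Merikoski2020_theorem1`, used hypothesis-style, never asserted).  No `sorry`, no new axioms, no `instance`, no notation.
Cell-original mathematics (FRONTIER formalisation; nothing here bears on the parity problem beyond the typed statements):
CONJECTURE C of the cell = every measurable `perℤ`-periodic four-point-free `U ⊆ ℝ` has `μ(U ∩ [0,per)) ≤ per/2`,
sharp (mid arc); pay-off: residues of the prime-gap limit-point set `𝓛` modulo `λ` cover ≥ half of `[0, λ)` for every
`λ > 0`, given Merikoski's four-point theorem.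
-/

namespace Summit.Parity.GeneralizedHardyLittlewood.Theorems.PrimeGapTorusCap
open MeasureTheory Set Filter Topology NearAP

/-- **THE CELL TRANSFER THEOREM.**  `(Δ_lin)_ℤ` for INFINITELY MANY `N` implies, for every measurable 1-periodic
`U` with `μ(U ∩ [0,1)) > 2/5`:  `μ(D₃U ∩ [0,1)) ≥ min(μ(U ∩ [0,1)), ½)`. -/
theorem min_le_volume_D3_of_conjLinZ_frequently (h : ∃ᶠ n in atTop, ConjLinZAt n) {U : Set ℝ}
    (hU : MeasurableSet U) (hP : Periodic1 U) (h25 : ENNReal.ofReal (2 / 5) < volume (U ∩ Set.Ico (0 : ℝ) 1)) :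
    min (volume (U ∩ Set.Ico (0 : ℝ) 1)) (ENNReal.ofReal (1 / 2)) ≤ volume (D3 U ∩ Set.Ico (0 : ℝ) 1) := by
  classical
  have hI1 : volume (Set.Ico (0 : ℝ) 1) = 1 := by simp [Real.volume_Ico]
  have hUle : volume (U ∩ Set.Ico (0 : ℝ) 1) ≤ 1 := hI1 ▸ measure_mono Set.inter_subset_right
  have hVle : volume (D3 U ∩ Set.Ico (0 : ℝ) 1) ≤ 1 := hI1 ▸ measure_mono Set.inter_subset_right
  have hUfin : volume (U ∩ Set.Ico (0 : ℝ) 1) ≠ ⊤ := ne_top_of_le_ne_top ENNReal.one_ne_top hUle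
  have hVfin : volume (D3 U ∩ Set.Ico (0 : ℝ) 1) ≠ ⊤ := ne_top_of_le_ne_top ENNReal.one_ne_top hVle
  set u : ℝ := (volume (U ∩ Set.Ico (0 : ℝ) 1)).toReal with hu
  set v : ℝ := (volume (D3 U ∩ Set.Ico (0 : ℝ) 1)).toReal with hv
  have hUeq : volume (U ∩ Set.Ico (0 : ℝ) 1) = ENNReal.ofReal u := (ENNReal.ofReal_toReal hUfin).symm
  have hVeq : volume (D3 U ∩ Set.Ico (0 : ℝ) 1) = ENNReal.ofReal v := (ENNReal.ofReal_toReal hVfin).symm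
  have hu0 : 0 ≤ u := ENNReal.toReal_nonneg
  have hv0 : 0 ≤ v := ENNReal.toReal_nonneg
  have hu1 : u ≤ 1 := by
    have := ENNReal.toReal_mono ENNReal.one_ne_top hUle
    simpa using this
  have hu25 : 2 / 5 < u := by
    rw [hUeq, ENNReal.ofReal_lt_ofReal_iff'] at h25
    exact h25.1
  rw [hUeq, hVeq, ← ENNReal.ofReal_min]
  apply ENNReal.ofReal_le_ofReal
  -- real-number goal: min u (1/2) ≤ v ; we show min u (1/2) - δ ≤ v for every small δ > 0
  by_contra hlt
  push Not at hlt
  set δ : ℝ := min ((min u (1 / 2) - v) / 2) 1 with hδ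
  have hδ0 : 0 < δ := lt_min (by linarith) one_pos
  have hδ1 : δ ≤ 1 := min_le_right _ _
  have hδv : v + δ < min u (1 / 2) := by
    have : δ ≤ (min u (1 / 2) - v) / 2 := min_le_left _ _
    linarith
  -- parameters
  set η : ℝ := δ / 20 with hη
  have hη0 : 0 < η := by positivity
  have hη10 : η ≤ 1 / 10 := by rw [hη]; linarith
  set ε : ℝ := min (δ / 4) ((u - 2 / 5) / 2) with hε
  have hε0 : 0 < ε := lt_min (by positivity) (by linarith)
  have hε4 : ε ≤ δ / 4 := min_le_left _ _
  have hεu : ε ≤ (u - 2 / 5) / 2 := min_le_right _ _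
  obtain ⟨n₀, hn₀⟩ := badSet_eventually_small hU hη0 (by linarith) (ε := ENNReal.ofReal ε) (ENNReal.ofReal_pos.2 hε0)
  obtain ⟨m, hm⟩ := exists_nat_ge ((n₀ : ℝ) + 10 + 20 / δ)
  obtain ⟨n, hnm, hn'⟩ := Filter.frequently_atTop.1 h m
  have hn : (n₀ : ℝ) + 10 + 20 / δ ≤ n := hm.trans (by exact_mod_cast hnm)
  have h20δ : 0 < 20 / δ := by positivity
  have hn0 : n₀ ≤ n + 1 := by
    have : (n₀ : ℝ) ≤ n + 1 := by linarith
    exact_mod_cast this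
  have hn9 : 9 ≤ n := by
    have : (9 : ℝ) ≤ n := by linarith [(Nat.cast_nonneg n₀ : (0 : ℝ) ≤ n₀)]
    exact_mod_cast this
  have hNpos : (0 : ℝ) < (n : ℝ) + 1 := by positivity
  have hNδ : 1 / ((n : ℝ) + 1) ≤ δ / 20 := by
    rw [div_le_div_iff₀ hNpos (by norm_num : (0 : ℝ) < 20)]
    have : 20 / δ ≤ (n : ℝ) + 1 := by linarith [(Nat.cast_nonneg n₀ : (0 : ℝ) ≤ n₀)]
    rw [div_le_iff₀ hδ0] at this
    linarith
  -- the dense residues at resolution N = n+1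
  obtain ⟨S, hSsound, hScomp⟩ : ∃ S : Finset (ZMod (n + 1)), (∀ s ∈ S, CellDense U (n + 1) η (s.val : ℤ)) ∧
      (∀ s : ZMod (n + 1), CellDense U (n + 1) η (s.val : ℤ) → s ∈ S) :=
    ⟨Finset.univ.filter fun s => CellDense U (n + 1) η (s.val : ℤ), fun s hs => (Finset.mem_filter.1 hs).2,
      fun s hs => Finset.mem_filter.2 ⟨Finset.mem_univ _, hs⟩⟩
  -- (1) the count:  u ≤ ε + |S|/N
  have hcount : u ≤ ε + (S.card : ℝ) / ((n : ℝ) + 1) := by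
    have h1 := volume_le_badSet_add_card hP η S hScomp
    have h2 := hn₀ (n + 1) hn0
    have h3 : volume (U ∩ Set.Ico (0 : ℝ) 1) ≤
        ENNReal.ofReal ε + (S.card : ENNReal) * ENNReal.ofReal (1 / ((n + 1 : ℕ) : ℝ)) :=
      h1.trans (add_le_add h2 le_rfl)
    have hSn : (0 : ℝ) ≤ (S.card : ℝ) * (1 / ((n + 1 : ℕ) : ℝ)) :=
      mul_nonneg (Nat.cast_nonneg _) (one_div_nonneg.2 (Nat.cast_nonneg _))
    rw [hUeq, ← ENNReal.ofReal_natCast, ← ENNReal.ofReal_mul (Nat.cast_nonneg _),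
      ← ENNReal.ofReal_add hε0.le hSn, ENNReal.ofReal_le_ofReal_iff (add_nonneg hε0.le hSn)] at h3
    have hN1 : ((n + 1 : ℕ) : ℝ) = (n : ℝ) + 1 := by push_cast; ring
    rw [hN1] at h3
    have ee : (S.card : ℝ) * (1 / ((n : ℝ) + 1)) = (S.card : ℝ) / ((n : ℝ) + 1) := by ring
    linarith [ee]
  -- (2) the D₃ bound for S:  cnt(S)·(½-5η)/N ≤ v
  have hD3 : ((d3plusCard S + d3minusCard S : ℕ) : ℝ) * ((1 / 2 - 5 * η) / ((n : ℝ) + 1)) ≤ v := by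
    have h1 := count_mul_le_volume_D3 hU hP hη0 S hSsound
    rw [hVeq] at h1
    have h2 := ENNReal.toReal_mono ENNReal.ofReal_ne_top h1
    have hN1 : ((n + 1 : ℕ) : ℝ) = (n : ℝ) + 1 := by push_cast; ring
    rw [ENNReal.toReal_mul, ENNReal.toReal_natCast, ENNReal.toReal_ofReal hv0, hN1,
      ENNReal.toReal_ofReal (div_nonneg (by linarith) hNpos.le)] at h2
    exact h2
  have hc0 : 0 ≤ (1 / 2 - 5 * η) / ((n : ℝ) + 1) := div_nonneg (by linarith) hNpos.le
  by_cases hsmall : 2 * S.card ≤ n + 1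
  · -- case |S| ≤ N/2: apply (Δ_lin)_ℤ to S itself
    have hbig : 2 * (n + 1) ≤ 5 * S.card := by
      have hr : (2 : ℝ) * ((n : ℝ) + 1) ≤ 5 * (S.card : ℝ) := by
        have : (u - ε) * ((n : ℝ) + 1) ≤ S.card := by
          have := hcount
          rw [← sub_le_iff_le_add'] at this
          rwa [le_div_iff₀ hNpos] at this
        nlinarith
      exact_mod_cast hr
    have hlin := hn' S hbig hsmall
    have hlinR : (2 : ℝ) * S.card ≤ ((d3plusCard S + d3minusCard S : ℕ) : ℝ) := by exact_mod_cast hlin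
    -- v ≥ 2|S|(½-5η)/N ≥ (u-ε)(1-10η) ≥ u - ε - 10 η
    have hv1 : 2 * (S.card : ℝ) * ((1 / 2 - 5 * η) / ((n : ℝ) + 1)) ≤ v :=
      le_trans (mul_le_mul_of_nonneg_right hlinR hc0) hD3
    have hSN : (u - ε) ≤ (S.card : ℝ) / ((n : ℝ) + 1) := by linarith
    have hv2 : (u - ε) * (1 - 10 * η) ≤ v := by
      have e1 : 2 * (S.card : ℝ) * ((1 / 2 - 5 * η) / ((n : ℝ) + 1)) =
          (S.card : ℝ) / ((n : ℝ) + 1) * (1 - 10 * η) := by ring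
      rw [e1] at hv1
      exact le_trans (mul_le_mul_of_nonneg_right hSN (by linarith)) hv1
    have hv3 : u - ε - 10 * η ≤ v := by
      nlinarith [mul_nonneg hη0.le (by linarith : (0 : ℝ) ≤ 1 - u + ε)]
    have : min u (1 / 2) ≤ u := min_le_left _ _
    rw [hη] at hv3
    linarith
  · -- case |S| > N/2: apply (Δ_lin)_ℤ to a subset T of size ⌊N/2⌋
    push Not at hsmall
    obtain ⟨T, hTS, hTcard⟩ := Finset.exists_subset_card_eq (s := S) (n := (n + 1) / 2) (by omega)
    have hlin := hn' T (by omega) (by omega)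
    have hmono := d3Cards_mono hTS
    have hcnt : n ≤ d3plusCard S + d3minusCard S := by omega
    have hcntR : (n : ℝ) ≤ ((d3plusCard S + d3minusCard S : ℕ) : ℝ) := by exact_mod_cast hcnt
    have hv1 : (n : ℝ) * ((1 / 2 - 5 * η) / ((n : ℝ) + 1)) ≤ v :=
      le_trans (mul_le_mul_of_nonneg_right hcntR hc0) hD3
    -- n/(n+1) = 1 - 1/(n+1) ≥ 1 - δ/20
    have hq : (n : ℝ) / ((n : ℝ) + 1) = 1 - 1 / ((n : ℝ) + 1) := by
      rw [eq_sub_iff_add_eq, ← add_div, div_self hNpos.ne']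
    have hv2 : (1 - δ / 20) * (1 / 2 - 5 * η) ≤ v := by
      have e1 : (n : ℝ) * ((1 / 2 - 5 * η) / ((n : ℝ) + 1)) = (n : ℝ) / ((n : ℝ) + 1) * (1 / 2 - 5 * η) := by
        ring
      rw [e1, hq] at hv1
      exact le_trans (mul_le_mul_of_nonneg_right (by linarith) (by linarith)) hv1
    have : min u (1 / 2) ≤ 1 / 2 := min_le_right _ _
    rw [hη] at hv2
    nlinarith [sq_nonneg δ]

end Summit.Parity.GeneralizedHardyLittlewood.Theorems.PrimeGapTorusCap
namespace Summit.Parity.GeneralizedHardyLittlewood.Theorems.PrimeGapTorusCap.NearAP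
end Summit.Parity.GeneralizedHardyLittlewood.Theorems.PrimeGapTorusCap.NearAP
/-! ### AK.7 the reflection symmetry `|D₃⁻S| = |D₃⁺S|` and the HALVED form of `(Δ_lin)_ℤ`

`D₃U` is symmetric under `d ↦ -d`, and `d ↦ -d` maps the lower half of grid cell `j` onto the upper half of cell `-j-1`;
on residues this is the bijection `j ↦ -j-1` between `{j : P1 j ∨ P2 j ∨ P0 (j+1)}` and `{j : P0 j ∨ P1 j ∨ P2 j}`.  Hence
`cnt(S) = |D₃⁺S| + |D₃⁻S| = 2|D₃⁺S|` and `(Δ_lin)_ℤ ⟺ (2N ≤ 5|S| ≤ 5N/2 ⟹ |S| ≤ |D₃⁺S|)` with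
`D₃⁺S = {j : S ⊇ {s, s+a, s+a+b} for some s and (a,b) ∈ {(j,j), (j,j+1), (j+1,j)}}` (ROUND-10 instrument Q uses this form). -/

namespace Summit.Parity.GeneralizedHardyLittlewood.Theorems.PrimeGapTorusCap.NearAP
variable {N : ℕ}
/-- (cell parity-ideate p4, Sketch16 — helper; statement verbatim) -/
theorem P0_neg_sub_one_iff (S : Finset (ZMod N)) (j : ZMod N) : P0 S (-j - 1) ↔ P0 S (j + 1) := by
  constructor
  · rintro ⟨s, hs, h1, h2⟩
    exact ⟨s + 2 * (-j - 1), h2, by convert h1 using 1; ring, by convert hs using 1; ring⟩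
  · rintro ⟨s, hs, h1, h2⟩
    exact ⟨s + 2 * (j + 1), h2, by convert h1 using 1; ring, by convert hs using 1; ring⟩

/-- (cell parity-ideate p4, Sketch16 — helper; statement verbatim) -/
theorem P0_neg_iff (S : Finset (ZMod N)) (j : ZMod N) : P0 S (-j) ↔ P0 S j := by
  have := P0_neg_sub_one_iff S (j - 1)
  simp only [neg_sub, sub_add_cancel] at this
  rw [← this]; congr! 1; ring

/-- (cell parity-ideate p4, Sketch16 — helper; statement verbatim) -/
theorem P1_neg_sub_one_iff (S : Finset (ZMod N)) (j : ZMod N) : P1 S (-j - 1) ↔ P1 S j := by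
  constructor
  · rintro ⟨s, hs, h1, h2⟩
    exact ⟨s + 2 * (-j - 1) + 1, h2, by convert h1 using 1; ring, by convert hs using 1; ring⟩
  · rintro ⟨s, hs, h1, h2⟩
    exact ⟨s + 2 * j + 1, h2, by convert h1 using 1; ring, by convert hs using 1; ring⟩

/-- (cell parity-ideate p4, Sketch16 — helper; statement verbatim) -/
theorem P2_neg_sub_one_iff (S : Finset (ZMod N)) (j : ZMod N) : P2 S (-j - 1) ↔ P2 S j := by
  constructor
  · rintro ⟨s, hs, h1, h2⟩
    exact ⟨s + 2 * (-j - 1) + 1, h2, by convert h1 using 1; ring, by convert hs using 1; ring⟩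
  · rintro ⟨s, hs, h1, h2⟩
    exact ⟨s + 2 * j + 1, h2, by convert h1 using 1; ring, by convert hs using 1; ring⟩

variable [NeZero N]
/-- **Reflection symmetry** `|D₃⁻S| = |D₃⁺S|` via `j ↦ -j-1`. -/
theorem d3minusCard_eq_d3plusCard (S : Finset (ZMod N)) : d3minusCard S = d3plusCard S := by
  unfold d3minusCard d3plusCard
  refine Finset.card_bij' (fun j _ => -j - 1) (fun j _ => -j - 1) ?_ ?_ (fun j _ => by ring) (fun j _ => by ring)
  · intro j hj
    simp only [Finset.mem_filter, Finset.mem_univ, true_and] at hj ⊢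
    rcases hj with h | h | h
    · exact Or.inr (Or.inl ((P1_neg_sub_one_iff S j).2 h))
    · exact Or.inr (Or.inr ((P2_neg_sub_one_iff S j).2 h))
    · exact Or.inl ((P0_neg_sub_one_iff S j).2 h)
  · intro j hj
    simp only [Finset.mem_filter, Finset.mem_univ, true_and] at hj ⊢
    rcases hj with h | h | h
    · refine Or.inr (Or.inr ?_)
      rw [show -j - 1 + 1 = -j by ring]
      exact (P0_neg_iff S j).2 h
    · exact Or.inl ((P1_neg_sub_one_iff S j).2 h)
    · exact Or.inr (Or.inl ((P2_neg_sub_one_iff S j).2 h))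

end Summit.Parity.GeneralizedHardyLittlewood.Theorems.PrimeGapTorusCap.NearAP
/-! ## §AK.8 (ROUND-10) THE ARC RUNG FOR EVERY MODULUS
`k ≤ d3plusCard (arc N k)` for `2k ≤ N`: the halved inequality `|S| ≤ |D₃⁺S|` holds with EQUALITY-size witnesses on arcs in every `ℤ_N`
(witness set `{0,…,⌊(k-1)/2⌋} ∪ {-1,…,-⌊k/2⌋}`; patterns `P0` at `s = 0` and `P1` at `s = 2m+1`). -/

namespace Summit.Parity.GeneralizedHardyLittlewood.Theorems.PrimeGapTorusCap.NearAP
variable {N : ℕ}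
/-- The arc `{0, 1, …, k-1} ⊂ ℤ_N`. -/
def arc (N k : ℕ) : Finset (ZMod N) := (Finset.range k).image (fun i : ℕ => (i : ZMod N))

variable [NeZero N]
end Summit.Parity.GeneralizedHardyLittlewood.Theorems.PrimeGapTorusCap.NearAP
namespace Summit.Parity.GeneralizedHardyLittlewood.Theorems.PrimeGapTorusCap.NearAP
variable {N : ℕ}
variable {M : ℕ} [NeZero N] [NeZero M]
end Summit.Parity.GeneralizedHardyLittlewood.Theorems.PrimeGapTorusCap.NearAP
namespace Summit.Parity.GeneralizedHardyLittlewood.Theorems.PrimeGapTorusCap.NearAP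
variable {N : ℕ}
variable [NeZero N]
end Summit.Parity.GeneralizedHardyLittlewood.Theorems.PrimeGapTorusCap.NearAP
namespace Summit.Parity.GeneralizedHardyLittlewood.Theorems.PrimeGapTorusCap.NearAP
variable {N : ℕ}
variable [NeZero N]
end Summit.Parity.GeneralizedHardyLittlewood.Theorems.PrimeGapTorusCap.NearAP
/-! ## §AK.12 (ROUND-10) DIHEDRAL INVARIANCE OF THE HALVED STATISTIC
`d3plusCard_reflect : d3plusCard (reflectSet c S) = d3plusCard S` and `d3plusCard_translate`: the set `D₃⁺S` itself is invariant under
every reflection `x ↦ c - x` (which fixes `P0` and swaps `P1 ↔ P2` pointwise in `j`) and every translation.  So `ConjLinZ'` may be checked on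
one representative per dihedral class (what instruments P/Q/R/S enumerate), and the two gaps of a two-arc may be exchanged (`twoArc N a g` is a
reflection of `twoArc N a (N-2a-g)`), the normalisation used by the ANTIPODAL LEMMA of ROUND-10.md §1.5(d).  NOT invariant: dilations
`x ↦ λx` (the carry `+1`), whose cost ≈ λ/2 is the rigidity input of the inverse statement INV(m) (ROUND-10.md §1.3c). -/

namespace Summit.Parity.GeneralizedHardyLittlewood.Theorems.PrimeGapTorusCap.NearAP
variable {N : ℕ}
/-- The translated set `S + c`. -/
def translateSet (c : ZMod N) (S : Finset (ZMod N)) : Finset (ZMod N) := S.image (fun x => x + c)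

variable [NeZero N]
end Summit.Parity.GeneralizedHardyLittlewood.Theorems.PrimeGapTorusCap.NearAP
namespace Summit.Parity.GeneralizedHardyLittlewood.Theorems.PrimeGapTorusCap.NearAP
variable {N : ℕ}
variable [NeZero N]
end Summit.Parity.GeneralizedHardyLittlewood.Theorems.PrimeGapTorusCap.NearAP
namespace Summit.Parity.GeneralizedHardyLittlewood.Theorems.PrimeGapTorusCap.NearAP
variable {N : ℕ}
variable [NeZero N]
end Summit.Parity.GeneralizedHardyLittlewood.Theorems.PrimeGapTorusCap.NearAP
namespace Summit.Parity.GeneralizedHardyLittlewood.Theorems.PrimeGapTorusCap.NearAP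
variable {N : ℕ}
variable [NeZero N]
end Summit.Parity.GeneralizedHardyLittlewood.Theorems.PrimeGapTorusCap.NearAP
/-! ## §AL (ROUND-12) THEOREM R★ AND THE TOP SLICE — the content of `round11/PolyRung.lean` v11 (sha16 9f96b481d9a0c5ab, farm rc 0),
VERBATIM from its `namespace` line to its end, minus the declarations already made above (`P0 P1 P2`, their `Decidable` instances, `d3plusCard`, `arc`, `translateSet`; the private `natCast_inj_of_lt` renamed `natCast_inj_of_lt_pr`).
Its module docstring (the desk argument for R★ via the Alon–Nathanson–Ruzsa polynomial method, `Literature.Combinatorics.Additive.ErdosHeilbronn`) is not repeated. -/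

namespace Summit.Parity.GeneralizedHardyLittlewood.Theorems.PrimeGapTorusCap.NearAP
variable {N : ℕ}
/-- Number of runs (maximal intervals) of `S ⊂ ℤ_N`: elements whose predecessor is not in `S`. -/
def runCount (S : Finset (ZMod N)) : ℕ := (S.filter fun s => s - 1 ∉ S).card

/-- Binomial coefficient in closed form (kernel-friendly: `k` multiplications). Equals `Nat.choose`
(`Nat.choose_eq_descFactorial_div_factorial`). -/
def binomF (n k : ℕ) : ℕ := Nat.descFactorial n k / Nat.factorial k

/-- (cell parity-ideate p4, Sketch16 — helper; statement verbatim) -/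
theorem binomF_eq_choose (n k : ℕ) : binomF n k = Nat.choose n k := by
  unfold binomF; rw [Nat.choose_eq_descFactorial_div_factorial]

/-! ### Theorem R★ — the uniform form (padding `d = ρ - (p+1-2k)` makes `K = k-1` and the certificate the central Delannoy number).

With `h(a',b) := ∏_{c ∉ S} ((b-a')/2 - c) · b^{ρ-(p+1-2k)}` (degree `k+ρ-1`), `A = -S`, `B = T`: `K = k-1`, and the coefficient of
`x^{k-1} y^{k+ρ-1}` in `(x+y)^{k-1} h_top` is `2^{-(p-k)} Σ_i (-1)^i C(k-1,i) C(p-k,i) ≡ 2^{-(p-k)} D_{k-1} (mod p)`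
(`(1-x)^{p-k} ≡ (1-x^p)(1-x)^{-k}`; congruence checked on 200 random `(p,k)`).  Hence:

**R★.** `p` odd prime, `S ⊂ ℤ_p`, `|S| = k`, `2k ≤ p`, `runCount S ≥ p+1-2k`, `p ∤ D_{k-1}`  ⟹  `|D₃⁺S| ≥ k`.

`p | D_{k-1}` happens on sporadic window slices (32 pairs `(p,k)` with `p < 2500`, e.g. `(31,13), (137,65), (179,72)`), never on the
top slice `k = (p-1)/2` for `p < 6000` (and `D_{(p-1)/2} ≡ 0 ⇔ p ≡ 3 (mod 4)`, the CM curve `y² = x³ - x`). -/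

/-- Central Delannoy numbers `D_n = Σ_t C(n,t)·C(n+t,t)` (closed-form binomials). -/
def delannoyC (n : ℕ) : ℕ := ∑ t ∈ Finset.range (n + 1), binomF n t * binomF (n + t) t

/-- **Theorem R★ (uniform polynomial rung)** — desk-proved this round; to be formalised on top of the ANR lemma. -/
def PolyRungStar : Prop :=
  ∀ p : ℕ, (hp : p.Prime) → p ≠ 2 → ∀ S : Finset (ZMod p),
    2 * S.card ≤ p → p + 1 ≤ 2 * S.card + runCount S → delannoyC (S.card - 1) % p ≠ 0 →
    S.card ≤ @d3plusCard p ⟨hp.ne_zero⟩ S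

/-- **Q-R1 (open, verified for all primes `p < 6000`):** `p ∤ D_{(p-3)/2}`.  Equivalent (three-term recurrence at `n=(p+1)/2`)
to `p ∤ D_{(p+1)/2}`. -/
def DelannoyNonVanishing : Prop := ∀ p : ℕ, p.Prime → 5 ≤ p → delannoyC ((p - 3) / 2) % p ≠ 0

/-! ## `RunOneIsArc` at primes — proved (removes one hypothesis of the top-slice theorems at primes). -/

section runone
variable {p : ℕ} [hp : Fact p.Prime]
/-- (cell parity-ideate p4, Sketch16 — helper; statement verbatim) -/
lemma natCast_inj_of_lt_pr {i j : ℕ} (hi : i < p) (hj : j < p) (h : (i : ZMod p) = (j : ZMod p)) : i = j := by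
  have h1 : ((i : ZMod p)).val = i := by rw [ZMod.val_natCast]; exact Nat.mod_eq_of_lt hi
  have h2 : ((j : ZMod p)).val = j := by rw [ZMod.val_natCast]; exact Nat.mod_eq_of_lt hj
  rw [← h1, ← h2, h]

/-- If every element of `S` has its predecessor in `S`, then `S = univ` (orbit of `x ↦ x - 1` is everything in `ZMod p`). -/
lemma eq_univ_of_pred_closed (S : Finset (ZMod p)) (hne : S.Nonempty) (hcl : ∀ s ∈ S, s - 1 ∈ S) : S = Finset.univ := by
  obtain ⟨s₀, hs₀⟩ := hne
  have key : ∀ n : ℕ, s₀ - (n : ZMod p) ∈ S := by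
    intro n
    induction n with
    | zero => simpa using hs₀
    | succ n ih =>
      have := hcl _ ih
      simpa [sub_sub, Nat.cast_succ] using this
  ext x
  simp only [Finset.mem_univ, iff_true]
  have hx : x = s₀ - (((s₀ - x).val : ℕ) : ZMod p) := by
    rw [ZMod.natCast_zmod_val]; ring
  rw [hx]; exact key _

end runone
end Summit.Parity.GeneralizedHardyLittlewood.Theorems.PrimeGapTorusCap.NearAP
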